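import Mathlib
import HarnessLib
import Summits.KontsevichZagierPeriods.Zeta5Search.SorokinIntegrandBounds

/-!
# ζ(5) search — the complex-parameter forms of Zudilin's `F_m` and `J_k` restrict to the typed real ones (cell `pub-zeta5`, ct-1 g27)

HONEST FRAMING: systematic search; no irrationality claim unless kernel-certified.  Cast bookkeeping (`ℝ ↪ ℂ`) for the typed objects
`Zudilin2002.vwpSeries`, `Zudilin2002.sorokinIntegrand`, `Zudilin2002.sorokinIntegral`; nothing here is an irrationality result, a
worthiness exponent or a denominator statement; no named fact is discharged; no definition is introduced.

The induction (13)–(14) of Zudilin math/0206177 runs at COMPLEX (shifted) parameters, so the lineage's bricks B3/B4/B6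
(`HOME/ct-1/g26/VWP-BLUEPRINT.md`) state the very-well-poised series and the multiple integral INLINE over `ℂ`:

  `F_m(h) = Σ' μ, (h₀+2μ) ∏_{j≤m} Γ(h_j+μ)/Γ(1+h₀−h_j+μ) (−1)^{(m+1)μ}`  (`h : ℕ → ℂ`),
  `J_k`-integrand `∏ x_j^{a_j−1}(1−x_j)^{b_j−a_j−1} Q_k^{−a₀}` (principal `cpow`, complex `a₀, a_j, b_j`).

This file is the blueprint's "`_ofReal`" brick B7-prep WITHOUT definition items: at real parameters these inline complex expressions
are the casts of the typed real ones —

* `integrand_ofReal` (closed cube, pointwise), `setIntegral_ofReal` (`∫_{[0,1]^k}` of the complex integrand `= ↑(sorokinIntegral k a₀ a b)`);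
* `vwpSeries_ofReal` (the complex series at `h ↦ (h n : ℂ)` `= ↑(vwpSeries m h)`).

Theorems only; imports `Zeta5Search/SorokinIntegrandBounds`.
-/

noncomputable section

namespace Summit.KontsevichZagierPeriods.Zeta5Search.VWPOfReal

open MeasureTheory Set
open Literature.NumberTheory.Irrationality.Zudilin2002 (nestedQ sorokinIntegrand sorokinIntegral vwpSeries)
open Summit.KontsevichZagierPeriods.Zeta5Search.SorokinIntegrandBounds

/-! ### 1. The integral side -/

/-- On the closed cube, at REAL parameters the complex-parameter integrand is the cast of the typed real integrand. -/
theorem integrand_ofReal (k : ℕ) (a₀ : ℝ) (a b : ℕ → ℝ) {x : Fin k → ℝ} (hx : ∀ j, x j ∈ Icc (0 : ℝ) 1) :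
    (∏ j : Fin k, ((x j : ℝ) : ℂ) ^ (((a j : ℝ) : ℂ) - 1) * (1 - ((x j : ℝ) : ℂ)) ^ (((b j : ℝ) : ℂ) - ((a j : ℝ) : ℂ) - 1)) *
        ((nestedQ (List.ofFn x) : ℝ) : ℂ) ^ (-((a₀ : ℝ) : ℂ)) =
      ((sorokinIntegrand k a₀ a b x : ℝ) : ℂ) := by
  rw [sorokinIntegrand_eq k a₀ a b hx, neg_zero, Real.rpow_zero, mul_one, Complex.ofReal_mul, Complex.ofReal_prod,
    Complex.ofReal_cpow (nestedQ_ofFn_mem_Icc hx).1]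
  congr 1
  · refine Finset.prod_congr rfl fun j _ => ?_
    rw [Complex.ofReal_mul, Complex.ofReal_cpow (hx j).1, Complex.ofReal_cpow (by linarith [(hx j).2] : (0 : ℝ) ≤ 1 - x j)]
    push_cast
    rfl
  · push_cast
    rfl

/-- **`J_k` at real parameters**: the integral over `[0,1]^k` of the complex-parameter integrand at `(↑a₀, ↑a, ↑b)` is the cast of the
typed `sorokinIntegral k a₀ a b`. -/
theorem setIntegral_ofReal (k : ℕ) (a₀ : ℝ) (a b : ℕ → ℝ) :
    ∫ x in Set.pi univ (fun _ : Fin k => Icc (0 : ℝ) 1),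
        (∏ j : Fin k, ((x j : ℝ) : ℂ) ^ (((a j : ℝ) : ℂ) - 1) * (1 - ((x j : ℝ) : ℂ)) ^ (((b j : ℝ) : ℂ) - ((a j : ℝ) : ℂ) - 1)) *
          ((nestedQ (List.ofFn x) : ℝ) : ℂ) ^ (-((a₀ : ℝ) : ℂ)) =
      ((sorokinIntegral k a₀ a b : ℝ) : ℂ) := by
  rw [sorokinIntegral, ← integral_complex_ofReal]
  exact setIntegral_congr_fun (MeasurableSet.univ_pi fun _ => measurableSet_Icc) fun x hx =>
    integrand_ofReal k a₀ a b fun j => hx j (mem_univ _)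

/-! ### 2. The series side -/

/-- **`F_m` at real parameters**: the complex very-well-poised series at `h ↦ (h n : ℂ)` is the cast of the typed `vwpSeries m h`. -/
theorem vwpSeries_ofReal (m : ℕ) (h : ℕ → ℝ) :
    (∑' μ : ℕ, (((h 0 : ℝ) : ℂ) + 2 * μ) *
        (∏ j ∈ Finset.range (m + 1), Complex.Gamma (((h j : ℝ) : ℂ) + μ) / Complex.Gamma (1 + ((h 0 : ℝ) : ℂ) - ((h j : ℝ) : ℂ) + μ)) *
        (-1 : ℂ) ^ ((m + 1) * μ)) =
      ((vwpSeries m h : ℝ) : ℂ) := by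
  rw [vwpSeries, Complex.ofReal_tsum]
  refine tsum_congr fun μ => ?_
  have hΓ : ∀ r : ℝ, ((Real.Gamma r : ℝ) : ℂ) = Complex.Gamma (r : ℂ) := fun r => (Complex.Gamma_ofReal r).symm
  push_cast
  simp_rw [hΓ]
  push_cast
  rfl

end Summit.KontsevichZagierPeriods.Zeta5Search.VWPOfReal

end
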